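import Summits.CriticalPhenomena.PercolationContinuityZ3.Theorems.PercNearOneGluingNoHeavyLowerTailFrontierDecRowsEdgeInduction
import Literature.Probability.LatticeModels.ProdBernoulliIndependence
import Literature.Probability.LatticeModels.ProdBernoulliCoupling
import HarnessLib

/-!
# The second-order shadow of the chord through the origin: `Cov(A,B) ≥ p_e · Cov(A,B | e contracted)` for increasing events — a theorem

Support file for the Sahi programme (`--supports stmt-CriticalPhenomena-4575`, prover prim-sahi-p2 gen 30).  No definitions, no named facts, no
sorries; standard axioms.  Memo `run/shared/lean/prim/prim-sahi/FROM-prim-sahi-p2-gen30-VERTEX-INDUCTION-LIGHT-STEP.md` §9, §12(ii).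

Gen 30 reduces the increasing star to a ratio inequality along a root pair, `3c₂ ≥ 2c₃` (R23), resp. to the chord through the origin
`E₃(P_w) ≥ w(e)·E₃(P_{w[e↦1]})` (`IncStar.incStar_nonneg_of_contractionChord`).  This file proves the ORDER-TWO analogue outright, for arbitrary increasing
events `A, B` and an arbitrary pair `e`: with `g(λ) = Cov_{P_{w[e↦λ]}}(A,B) = (1−λ)²g₀ + 2λ(1−λ)g₁ + λ²g₂`,

* `two_polarCov_ge_cov` — the ratio inequality `2g₁ ≥ g₂`, for any two weights `p ≤ q` in place of `w[e↦0] ≤ w[e↦1]`: the identity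
  `2g₁ − g₂ = Cov_{P_p}(A,B) + (P_q(A) − P_p(A))(P_q(B) − P_p(B))` is Harris plus a product of two nonnegative increments;
* `cov_oneBond` — the Bernstein form of the covariance along one pair;
* `cov_ge_weight_mul_cov_contract` — **`Cov_{P_w}(A,B) ≥ w(e) · Cov_{P_{w[e↦1]}}(A,B)`**, i.e. `λ ↦ g(λ)/λ` does not increase from `λ = w(e)` to `1`.

The third-order version (R23 / CO) is the open crux; nothing here asserts it.
-/

noncomputable section

namespace Summit.CriticalPhenomena.PercolationContinuityZ3.Theorems

namespace EdgeInduction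

open MeasureTheory Literature.Probability.Percolation Literature.Probability.LatticeModels
open scoped Classical

variable {n : ℕ}

/-- **The order-two ratio inequality.**  For weights `p ≤ q` and increasing events `A, B`:
`P_q(A∩B) − P_q(A)P_q(B) ≤ P_p(A∩B) + P_q(A∩B) − P_p(A)P_q(B) − P_q(A)P_p(B)`, because the difference of the two sides is
`Cov_{P_p}(A,B) + (P_q(A) − P_p(A))·(P_q(B) − P_p(B)) ≥ 0` (Harris' inequality under `P_p`, monotonicity in the weights). [this work] -/
theorem two_polarCov_ge_cov {p q : Sym2 (Fin n) → unitInterval} (hpq : p ≤ q) {A B : Set (BondConfig (Fin n))}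
    (hA : IsUpperSet A) (hB : IsUpperSet B) :
    (prodBernoulli q).real (A ∩ B) - (prodBernoulli q).real A * (prodBernoulli q).real B ≤
      (prodBernoulli p).real (A ∩ B) + (prodBernoulli q).real (A ∩ B)
        - (prodBernoulli p).real A * (prodBernoulli q).real B - (prodBernoulli q).real A * (prodBernoulli p).real B := by
  have hAm : MeasurableSet A := MeasurableSet.of_discrete
  have hBm : MeasurableSet B := MeasurableSet.of_discrete
  have hH : (prodBernoulli p).real A * (prodBernoulli p).real B ≤ (prodBernoulli p).real (A ∩ B) :=
    prodBernoulli_harris p hA hB hAm hBm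
  have hmA : (prodBernoulli p).real A ≤ (prodBernoulli q).real A := prodBernoulli_real_mono_of_isUpperSet hpq hA hAm
  have hmB : (prodBernoulli p).real B ≤ (prodBernoulli q).real B := prodBernoulli_real_mono_of_isUpperSet hpq hB hBm
  nlinarith [mul_nonneg (sub_nonneg.2 hmA) (sub_nonneg.2 hmB)]

/-- Closing a pair gives a smaller weight than opening it: `w[e↦0] ≤ w[e↦1]`. [folklore] -/
theorem update_zero_le_update_one (w : Sym2 (Fin n) → unitInterval) (e : Sym2 (Fin n)) :
    Function.update w e (0 : unitInterval) ≤ Function.update w e 1 := by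
  intro f
  by_cases hf : f = e
  · subst hf; simp only [Function.update_self]; exact unitInterval.nonneg _
  · rw [Function.update_of_ne hf, Function.update_of_ne hf]

/-- **The covariance along one pair is a Bernstein quadratic**: with `λ = w(e)`, `P⁰ = P_{w[e↦0]}`, `P¹ = P_{w[e↦1]}`,
`Cov_{P_w}(A,B) = (1−λ)²·Cov_{P⁰}(A,B) + λ(1−λ)·[P⁰(A∩B) + P¹(A∩B) − P⁰(A)P¹(B) − P¹(A)P⁰(B)] + λ²·Cov_{P¹}(A,B)`. [this work] -/
theorem cov_oneBond (w : Sym2 (Fin n) → unitInterval) (e : Sym2 (Fin n)) (A B : Set (BondConfig (Fin n))) :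
    (prodBernoulli w).real (A ∩ B) - (prodBernoulli w).real A * (prodBernoulli w).real B =
      (1 - (w e : ℝ)) ^ 2 * ((prodBernoulli (Function.update w e 0)).real (A ∩ B)
          - (prodBernoulli (Function.update w e 0)).real A * (prodBernoulli (Function.update w e 0)).real B)
      + (w e : ℝ) * (1 - (w e : ℝ)) * ((prodBernoulli (Function.update w e 0)).real (A ∩ B)
          + (prodBernoulli (Function.update w e 1)).real (A ∩ B)
          - (prodBernoulli (Function.update w e 0)).real A * (prodBernoulli (Function.update w e 1)).real B
          - (prodBernoulli (Function.update w e 1)).real A * (prodBernoulli (Function.update w e 0)).real B)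
      + (w e : ℝ) ^ 2 * ((prodBernoulli (Function.update w e 1)).real (A ∩ B)
          - (prodBernoulli (Function.update w e 1)).real A * (prodBernoulli (Function.update w e 1)).real B) := by
  rw [stub_oneBondDecomp_k15 n w e (A ∩ B), stub_oneBondDecomp_k15 n w e A, stub_oneBondDecomp_k15 n w e B]
  ring

/-- **THE CHORD THROUGH THE ORIGIN FOR THE COVARIANCE (order-two shadow of (CO)).**  For increasing events `A, B`, every weight `w` and every pair `e`:
`w(e) · Cov_{P_{w[e↦1]}}(A,B) ≤ Cov_{P_w}(A,B)` — equivalently `λ ↦ Cov_{P_{w[e↦λ]}}(A,B)/λ` does not increase from `λ = w(e)` to `λ = 1`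
(`g(λ) − λg(1) = (1−λ)[(1−λ)g₀ + λ(2g₁ − g₂)] ≥ 0` by Harris and `two_polarCov_ge_cov`). [this work] -/
theorem cov_ge_weight_mul_cov_contract (w : Sym2 (Fin n) → unitInterval) (e : Sym2 (Fin n)) {A B : Set (BondConfig (Fin n))}
    (hA : IsUpperSet A) (hB : IsUpperSet B) :
    (w e : ℝ) * ((prodBernoulli (Function.update w e 1)).real (A ∩ B)
        - (prodBernoulli (Function.update w e 1)).real A * (prodBernoulli (Function.update w e 1)).real B) ≤
      (prodBernoulli w).real (A ∩ B) - (prodBernoulli w).real A * (prodBernoulli w).real B := by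
  have hAm : MeasurableSet A := MeasurableSet.of_discrete
  have hBm : MeasurableSet B := MeasurableSet.of_discrete
  have h0 : (prodBernoulli (Function.update w e 0)).real A * (prodBernoulli (Function.update w e 0)).real B ≤
      (prodBernoulli (Function.update w e 0)).real (A ∩ B) :=
    prodBernoulli_harris _ hA hB hAm hBm
  have h12 := two_polarCov_ge_cov (update_zero_le_update_one w e) hA hB
  have hp0 : (0 : ℝ) ≤ w e := (w e).2.1
  have hp1 : (w e : ℝ) ≤ 1 := (w e).2.2
  rw [cov_oneBond w e A B]
  set l : ℝ := (w e : ℝ) with hl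
  set a0 := (prodBernoulli (Function.update w e 0)).real (A ∩ B)
  set a := (prodBernoulli (Function.update w e 0)).real A
  set b := (prodBernoulli (Function.update w e 0)).real B
  set c1 := (prodBernoulli (Function.update w e 1)).real (A ∩ B)
  set c := (prodBernoulli (Function.update w e 1)).real A
  set d := (prodBernoulli (Function.update w e 1)).real B
  -- goal: l·(c1 − c d) ≤ (1−l)²(a0 − a b) + l(1−l)(a0 + c1 − a d − c b) + l²(c1 − c d)
  have key : (1 - l) ^ 2 * (a0 - a * b) + l * (1 - l) * (a0 + c1 - a * d - c * b) + l ^ 2 * (c1 - c * d) - l * (c1 - c * d)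
      = (1 - l) * ((1 - l) * (a0 - a * b) + l * ((a0 + c1 - a * d - c * b) - (c1 - c * d))) := by ring
  have hq : 0 ≤ 1 - l := sub_nonneg.2 hp1
  have h1 : 0 ≤ a0 - a * b := sub_nonneg.2 h0
  have h2 : 0 ≤ (a0 + c1 - a * d - c * b) - (c1 - c * d) := by linarith
  nlinarith [mul_nonneg hq (add_nonneg (mul_nonneg hq h1) (mul_nonneg hp0 h2)), key]

end EdgeInduction

end Summit.CriticalPhenomena.PercolationContinuityZ3.Theorems

end
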